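import Mathlib
import Summits.QuantumFields.BalabanUV.Beta.UnitLatticeOmegaBudgets
import Summits.QuantumFields.BalabanUV.Beta.UnitLatticeWalkInversionDecay

/-!
# `Summit.QuantumFields.BalabanUV.Beta.UnitLatticeOmegaLocal` — A3-loc-ω: THE NEAR-LOCAL INVERSES OF THE Ω HAND-OFF
# (`hPL`, `hloc`, budget `hL`) FROM THE SAME ONE LOCALISED PIECE BOUND + ONE GLOBAL COERCIVITY DATUM: with the
# convention «`near b` contains every piece with fewer than `m₀` cells», `1 + Knear_b = (1 + Σ_ω K_ω) − (far pieces)`,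
# the far pieces have row∕column mass `≤ e^{−w·m₀}·ρ`, so `1 + Knear_b` inherits `Re`-coercivity
# `γ − e^{−w m₀}(ρ + ρ_c)/2` from the datum `γ` of `1 + Σ_ω K_ω`; the pieces' decay `ρ·e^{−κ⁺d}` then gives ACCRETIVE
# Combes–Thomas local inverses `L_b := extend((compress (1 + Knear_b) □̃_b)⁻¹)` (`UnitLatticeWalkInversionDecay.locInv`)
# with ONE weighted-row-sum budget — the abstract supplier named in the row owner's O.2 interface list, now WIRED

HONEST FRAMING (page 1 of everything in this cell).  Discharging `FlowStep.BetaPertH` would make Bałaban's ultraviolet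
stability UNCONDITIONAL — a constructive-QFT result; NOT the continuum limit, NOT the Clay problem.  This module
discharges nothing of `BetaPertH`; [folklore] bookkeeping, kernel-checked (unit `b2b-balaban-beta-d4-p3`, road P3, gen 5;
skeleton v1.12 §7.9).  WHAT IT SETTLES (records): item (iii) of §7.9's residual list («the near-local inverses `L_b`
(`hPL`, `hloc`) with ONE `WRS` budget `hL` — abstract supplier `UnitLatticeLocalInverse`; instance datum = the coercivity
lower bound») is DERIVED here from: the ONE bound `hT` (rows) and its column twin `hTc` [= (T3) over NODE O.2, not moved],
the GLOBAL `Re`-coercivity datum `γ` of `1 + Σ_ω K_ω` [for the x-tilt layer (I4): `K = x·R·G̃₂·Rᵀ` is positive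
semidefinite, `γ = 1`; for the coarse layer (I3): G-B9-15's lower bound — the row owner's «coercivity datum», not moved],
symmetry of `d`, two lattice profiles `L₁`, `L` (geometry numbers), and the located smallness
`κ_c·ρ·L₁ < γ − e^{−w m₀}(ρ + ρ_c)/2` («rate × decay mass < coercivity»: R1∕R25 in our letters).  Nothing of Bałaban's
operators is instantiated; readiness width 0 unchanged; NOT summit progress.
HONEST DEPENDENCY: continuum YM on T⁴ ⇐ BetaPertH ∧ nine spine estimates (0/9 proved); BetaPertH ⇐
(D1) ∧ (D4) ∧ CAP+tail; G-an2-4 gates asym, D1 and NE2/3/4.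

CITATION (locator only; nothing printed is used as a hypothesis).  [13] = T. Bałaban, *Propagators for lattice gauge
theories in a background field*, Commun. Math. Phys. **99**, 389–434 (1985) [Balaban1985BackgroundPropagators], p. 422
(«The operators (QGQ*)⁻¹, or (QG₁Q*)⁻¹, can be analyzed in the same way as the operator (Q′G′²Q′*)⁻¹» — G-B9-15, the
coercivity datum) and (3.132)-type lower bounds; [II] = T. Bałaban, *Renormalization group approach to lattice gauge field
theories. II*, Commun. Math. Phys. **116**, 1–22 (1988) [Balaban1988RG2Cluster], p. 13 («generalized random walk
expansions … local inverses»), (1.11) p. 5.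

CONTENTS (0 sorry).  §1 the numerical-range bound `|Re z^*Rz| ≤ ½(J_r + J_c)‖z‖²` from row∕column sums and the coercivity
of a difference.  §2 from the ONE bound: decay of every partial sum of pieces (`norm_sum_pieces_le`), the far row∕column
masses (`rowFar_le`, `colFar_le`), `Ktot_sub_Knear`.  §3 `reCoercive_near`: `Re`-coercivity of `1 + Knear_b` on the whole
lattice.  §4 **`nearLocal_of_pieceMaj`**: for `L_b := locInv (Knear K near b) E b` the three hand-off inputs `hPL`, `hloc`,
`hL : WRS κ′ d L_b ((γ′ − κ_cρL₁)⁻¹·L)`, `γ′ = γ − e^{−w m₀}(ρ + ρ_c)/2`.  §5 non-vacuity.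
NOT HERE: the lattice profiles as numbers (kept as hypotheses `hL₁`, `hL`), any instance on Bałaban's operators.
NOT summit progress.
-/

open scoped BigOperators Matrix
open Finset Matrix Metric

namespace Summit.QuantumFields.BalabanUV.Beta.UnitLatticeOmegaLocal

open Summit.QuantumFields.BalabanUV.Beta.UnitLatticeWalkInversion
open Summit.QuantumFields.BalabanUV.Beta.UnitLatticeLocalInverse (compress extend Pj_mul_extend
  Pj_mul_mul_Pj_mul_extend_inv reCoercive_compress wrs_extend_inv_le)
open Summit.QuantumFields.BalabanUV.Beta.UnitLatticeWalkInversionDecay (locInv conjCoercive_compress_of_decay)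
open Summit.QuantumFields.BalabanUV.Beta.AccretiveCombesThomas (conjForm star_dotProduct_mulVec_eq isUnit_of_reCoercive)
open Summit.QuantumFields.BalabanUV.Beta.UnitLatticeOmegaTerms
open Summit.QuantumFields.BalabanUV.Beta.AnalyticWalkSum216RowResolvent (pieceMaj)
open Literature.MathematicalPhysics.QuantumFieldTheory.Balaban1983to89.B13PerturbativeStep (wrs WRS WeightHyp)
open Literature.MathematicalPhysics.QuantumFieldTheory.Balaban1983to89.B5Prop11Lower (nsq nsq_nonneg)

noncomputable section

variable {Y : Type*} [Fintype Y] [DecidableEq Y] {Ω : Type*} [Fintype Ω] [DecidableEq Ω] {Δ B : Type*}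

/-! ## §1 The numerical-range bound from row and column sums -/

omit [DecidableEq Y] in
/-- **`|Re z^*Rz| ≤ ½(J_r + J_c)·‖z‖²`** when the rows of `‖R‖` sum to `≤ J_r` and the columns to `≤ J_c` (AM–GM on
`|z_i|‖R_ij‖|z_j|`). [folklore] -/
theorem abs_re_form_le (R : Matrix Y Y ℂ) {Jr Jc : ℝ} (hr : ∀ i, ∑ j, ‖R i j‖ ≤ Jr) (hc : ∀ j, ∑ i, ‖R i j‖ ≤ Jc)
    (z : Y → ℂ) : |(star z ⬝ᵥ (R *ᵥ z)).re| ≤ (Jr + Jc) / 2 * nsq z := by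
  have h1 : |(star z ⬝ᵥ (R *ᵥ z)).re| ≤ ‖star z ⬝ᵥ (R *ᵥ z)‖ := Complex.abs_re_le_norm _
  have h2 : ‖star z ⬝ᵥ (R *ᵥ z)‖ ≤ ∑ i, ∑ j, ‖z i‖ * ‖R i j‖ * ‖z j‖ := by
    rw [star_dotProduct_mulVec_eq]
    refine (norm_sum_le _ _).trans (Finset.sum_le_sum fun i _ => ?_)
    refine (norm_sum_le _ _).trans (Finset.sum_le_sum fun j _ => ?_)
    rw [norm_mul, norm_mul, Complex.norm_conj]
  have h3 : ∑ i, ∑ j, ‖z i‖ * ‖R i j‖ * ‖z j‖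
      ≤ (∑ i, ‖z i‖ ^ 2 / 2 * ∑ j, ‖R i j‖) + ∑ j, ‖z j‖ ^ 2 / 2 * ∑ i, ‖R i j‖ := by
    have h31 : ∑ i, ∑ j, ‖z i‖ * ‖R i j‖ * ‖z j‖
        ≤ ∑ i, ∑ j, (‖z i‖ ^ 2 / 2 * ‖R i j‖ + ‖z j‖ ^ 2 / 2 * ‖R i j‖) := by
      refine Finset.sum_le_sum fun i _ => Finset.sum_le_sum fun j _ => ?_
      have : ‖z i‖ * ‖z j‖ ≤ ‖z i‖ ^ 2 / 2 + ‖z j‖ ^ 2 / 2 := by nlinarith [sq_nonneg (‖z i‖ - ‖z j‖)]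
      calc ‖z i‖ * ‖R i j‖ * ‖z j‖ = (‖z i‖ * ‖z j‖) * ‖R i j‖ := by ring
        _ ≤ (‖z i‖ ^ 2 / 2 + ‖z j‖ ^ 2 / 2) * ‖R i j‖ := mul_le_mul_of_nonneg_right this (norm_nonneg _)
        _ = _ := by ring
    refine h31.trans (le_of_eq ?_)
    rw [Finset.sum_congr rfl fun i _ => Finset.sum_add_distrib, Finset.sum_add_distrib]
    congr 1
    · exact Finset.sum_congr rfl fun i _ => by rw [Finset.mul_sum]
    · rw [Finset.sum_comm]
      exact Finset.sum_congr rfl fun j _ => by rw [Finset.mul_sum]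
  have h4 : (∑ i, ‖z i‖ ^ 2 / 2 * ∑ j, ‖R i j‖) ≤ Jr / 2 * nsq z := by
    rw [nsq, Finset.mul_sum]
    refine Finset.sum_le_sum fun i _ => ?_
    have := hr i
    have h0 : 0 ≤ ∑ j, ‖R i j‖ := Finset.sum_nonneg fun j _ => norm_nonneg _
    nlinarith [sq_nonneg ‖z i‖]
  have h5 : (∑ j, ‖z j‖ ^ 2 / 2 * ∑ i, ‖R i j‖) ≤ Jc / 2 * nsq z := by
    rw [nsq, Finset.mul_sum]
    refine Finset.sum_le_sum fun j _ => ?_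
    have := hc j
    have h0 : 0 ≤ ∑ i, ‖R i j‖ := Finset.sum_nonneg fun i _ => norm_nonneg _
    nlinarith [sq_nonneg ‖z j‖]
  linarith

omit [DecidableEq Y] in
/-- **Coercivity of a difference**: `A` `Re`-coercive with `γ` and `R` with row∕column sums `≤ J_r, J_c` ⟹ `A − R` is
`Re`-coercive with `γ − ½(J_r + J_c)`. [folklore] -/
theorem reCoercive_sub (A R : Matrix Y Y ℂ) {γ Jr Jc : ℝ} (hA : ∀ z : Y → ℂ, γ * nsq z ≤ (star z ⬝ᵥ (A *ᵥ z)).re)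
    (hr : ∀ i, ∑ j, ‖R i j‖ ≤ Jr) (hc : ∀ j, ∑ i, ‖R i j‖ ≤ Jc) (z : Y → ℂ) :
    (γ - (Jr + Jc) / 2) * nsq z ≤ (star z ⬝ᵥ ((A - R) *ᵥ z)).re := by
  have h := abs_re_form_le R hr hc z
  rw [Matrix.sub_mulVec, dotProduct_sub, Complex.sub_re]
  have := hA z
  have habs := (abs_le.1 h).2
  nlinarith

/-! ## §2 From the ONE localised piece bound -/

section OneBound

variable {d : Y → Y → ℝ}

omit [DecidableEq Y] [DecidableEq Ω] in
/-- **The localised bound controls every entry**: `Σ_ω e^{w·#cellsOf ω}‖K_ω(k,l)‖ ≤ ρ·e^{−κ⁺d(k,l)}` (one term of the row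
sum; the others are nonnegative). [folklore] -/
theorem sum_pieceMaj_le_exp {w κp ρ : ℝ} (K : Ω → Matrix Y Y ℂ) (cellsOf : Ω → Finset Δ)
    (hT : ∀ k, ∑ l, (∑ ω, pieceMaj w K cellsOf ω k l) * Real.exp (κp * d k l) ≤ ρ) (k l : Y) :
    ∑ ω, pieceMaj w K cellsOf ω k l ≤ ρ * Real.exp (-(κp * d k l)) := by
  have hnn : ∀ l', 0 ≤ (∑ ω, pieceMaj w K cellsOf ω k l') * Real.exp (κp * d k l') := fun l' =>
    mul_nonneg (Finset.sum_nonneg fun ω _ => mul_nonneg (Real.exp_pos _).le (norm_nonneg _)) (Real.exp_pos _).le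
  have h1 : (∑ ω, pieceMaj w K cellsOf ω k l) * Real.exp (κp * d k l) ≤ ρ :=
    (Finset.single_le_sum (fun l' _ => hnn l') (Finset.mem_univ l)).trans (hT k)
  rw [Real.exp_neg, ← div_eq_mul_inv, le_div_iff₀ (Real.exp_pos _)]
  exact h1

omit [DecidableEq Y] [DecidableEq Ω] in
/-- **Decay of EVERY partial sum of pieces** (in particular of `Knear_b` and of `Σ_ω K_ω`): `w ≥ 0` ⟹
`‖(Σ_{ω∈S} K_ω)(k,l)‖ ≤ ρ·e^{−κ⁺d(k,l)}`. [cite: Balaban1985BackgroundPropagators, Thm 3.10 (3.108) p.416] -/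
theorem norm_sum_pieces_le {w κp ρ : ℝ} (hw0 : 0 ≤ w) (K : Ω → Matrix Y Y ℂ)
    (cellsOf : Ω → Finset Δ) (hT : ∀ k, ∑ l, (∑ ω, pieceMaj w K cellsOf ω k l) * Real.exp (κp * d k l) ≤ ρ)
    (S : Finset Ω) (k l : Y) : ‖(∑ ω ∈ S, K ω) k l‖ ≤ ρ * Real.exp (-(κp * d k l)) := by
  refine le_trans ?_ (sum_pieceMaj_le_exp K cellsOf hT k l)
  rw [Matrix.sum_apply]
  refine (norm_sum_le _ _).trans ?_
  calc ∑ ω ∈ S, ‖K ω k l‖ ≤ ∑ ω, ‖K ω k l‖ :=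
        Finset.sum_le_univ_sum_of_nonneg fun ω => norm_nonneg _
    _ ≤ ∑ ω, pieceMaj w K cellsOf ω k l := Finset.sum_le_sum fun ω _ => by
        rw [pieceMaj]
        exact le_mul_of_one_le_left (norm_nonneg _) (Real.one_le_exp (mul_nonneg hw0 (Nat.cast_nonneg _)))

omit [Fintype Y] [DecidableEq Y] in
/-- `Σ_ω K_ω − Knear_b = Σ_{ω ∉ near b} K_ω` (the FAR pieces of cube `b`). [folklore] -/
theorem Ktot_sub_Knear (K : Ω → Matrix Y Y ℂ) (near : B → Finset Ω) (b : B) :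
    Ktot K - Knear K near b = ∑ ω ∈ Finset.univ.filter (fun ω => ω ∉ near b), K ω := by
  have h := Finset.sum_filter_add_sum_filter_not (Finset.univ : Finset Ω) (fun ω => ω ∈ near b) (fun ω => K ω)
  have h1 : Finset.univ.filter (fun ω => ω ∈ near b) = near b := by ext ω; simp
  rw [h1] at h
  rw [Ktot, Knear, ← h]
  abel

omit [Fintype Y] [DecidableEq Y] in
/-- **Far pieces are small, entrywise with the decoration weight**: under the convention «`ω ∉ near b ⟹ #cellsOf ω ≥ m₀`»
and `w ≥ 0`, `‖(Σ_{ω∉near b} K_ω)(k,l)‖ ≤ e^{−w m₀}·Σ_ω pieceMaj w K cellsOf ω (k,l)`. [folklore] -/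
theorem norm_far_apply_le {w m₀ : ℝ} (hw0 : 0 ≤ w) (K : Ω → Matrix Y Y ℂ) (cellsOf : Ω → Finset Δ)
    (near : B → Finset Ω) (hnear : ∀ b ω, ω ∉ near b → m₀ ≤ (cellsOf ω).card) (b : B) (k l : Y) :
    ‖(∑ ω ∈ Finset.univ.filter (fun ω => ω ∉ near b), K ω) k l‖
      ≤ Real.exp (-(w * m₀)) * ∑ ω, pieceMaj w K cellsOf ω k l := by
  rw [Matrix.sum_apply, Finset.mul_sum]
  refine (norm_sum_le _ _).trans ?_
  calc ∑ ω ∈ Finset.univ.filter (fun ω => ω ∉ near b), ‖K ω k l‖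
      ≤ ∑ ω ∈ Finset.univ.filter (fun ω => ω ∉ near b), Real.exp (-(w * m₀)) * pieceMaj w K cellsOf ω k l :=
        Finset.sum_le_sum fun ω hω => by
          rw [Finset.mem_filter] at hω
          rw [pieceMaj, ← mul_assoc, ← Real.exp_add]
          refine le_mul_of_one_le_left (norm_nonneg _) (Real.one_le_exp ?_)
          nlinarith [hnear b ω hω.2]
    _ ≤ ∑ ω, Real.exp (-(w * m₀)) * pieceMaj w K cellsOf ω k l :=
        Finset.sum_le_univ_sum_of_nonneg fun ω =>
          mul_nonneg (Real.exp_pos _).le (mul_nonneg (Real.exp_pos _).le (norm_nonneg _))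

omit [DecidableEq Y] in
/-- **Far ROW mass `≤ e^{−w m₀}·ρ`** (rows of the ONE bound; `κ⁺ ≥ 0`, `d ≥ 0`). [cite: Balaban1988RG2Cluster, (1.11) p.5] -/
theorem rowFar_le (hd0 : ∀ a b, 0 ≤ d a b) {w κp ρ m₀ : ℝ} (hw0 : 0 ≤ w) (hκp : 0 ≤ κp) (K : Ω → Matrix Y Y ℂ)
    (cellsOf : Ω → Finset Δ) (near : B → Finset Ω) (hnear : ∀ b ω, ω ∉ near b → m₀ ≤ (cellsOf ω).card)
    (hT : ∀ k, ∑ l, (∑ ω, pieceMaj w K cellsOf ω k l) * Real.exp (κp * d k l) ≤ ρ) (b : B) (k : Y) :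
    ∑ l, ‖(Ktot K - Knear K near b) k l‖ ≤ Real.exp (-(w * m₀)) * ρ := by
  rw [Ktot_sub_Knear]
  calc ∑ l, ‖(∑ ω ∈ Finset.univ.filter (fun ω => ω ∉ near b), K ω) k l‖
      ≤ ∑ l, Real.exp (-(w * m₀)) * ((∑ ω, pieceMaj w K cellsOf ω k l) * Real.exp (κp * d k l)) :=
        Finset.sum_le_sum fun l _ => (norm_far_apply_le hw0 K cellsOf near hnear b k l).trans (by
          refine mul_le_mul_of_nonneg_left ?_ (Real.exp_pos _).le
          exact le_mul_of_one_le_right (Finset.sum_nonneg fun ω _ => mul_nonneg (Real.exp_pos _).le (norm_nonneg _))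
            (Real.one_le_exp (mul_nonneg hκp (hd0 k l))))
    _ = Real.exp (-(w * m₀)) * ∑ l, (∑ ω, pieceMaj w K cellsOf ω k l) * Real.exp (κp * d k l) := by
        rw [Finset.mul_sum]
    _ ≤ Real.exp (-(w * m₀)) * ρ := mul_le_mul_of_nonneg_left (hT k) (Real.exp_pos _).le

omit [DecidableEq Y] in
/-- **Far COLUMN mass `≤ e^{−w m₀}·ρ_c`** (columns of the ONE bound). [cite: Balaban1988RG2Cluster, (1.11) p.5] -/
theorem colFar_le (hd0 : ∀ a b, 0 ≤ d a b) {w κp ρc m₀ : ℝ} (hw0 : 0 ≤ w) (hκp : 0 ≤ κp) (K : Ω → Matrix Y Y ℂ)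
    (cellsOf : Ω → Finset Δ) (near : B → Finset Ω) (hnear : ∀ b ω, ω ∉ near b → m₀ ≤ (cellsOf ω).card)
    (hTc : ∀ l, ∑ k, (∑ ω, pieceMaj w K cellsOf ω k l) * Real.exp (κp * d k l) ≤ ρc) (b : B) (l : Y) :
    ∑ k, ‖(Ktot K - Knear K near b) k l‖ ≤ Real.exp (-(w * m₀)) * ρc := by
  rw [Ktot_sub_Knear]
  calc ∑ k, ‖(∑ ω ∈ Finset.univ.filter (fun ω => ω ∉ near b), K ω) k l‖
      ≤ ∑ k, Real.exp (-(w * m₀)) * ((∑ ω, pieceMaj w K cellsOf ω k l) * Real.exp (κp * d k l)) :=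
        Finset.sum_le_sum fun k _ => (norm_far_apply_le hw0 K cellsOf near hnear b k l).trans (by
          refine mul_le_mul_of_nonneg_left ?_ (Real.exp_pos _).le
          exact le_mul_of_one_le_right (Finset.sum_nonneg fun ω _ => mul_nonneg (Real.exp_pos _).le (norm_nonneg _))
            (Real.one_le_exp (mul_nonneg hκp (hd0 k l))))
    _ = Real.exp (-(w * m₀)) * ∑ k, (∑ ω, pieceMaj w K cellsOf ω k l) * Real.exp (κp * d k l) := by
        rw [Finset.mul_sum]
    _ ≤ Real.exp (-(w * m₀)) * ρc := mul_le_mul_of_nonneg_left (hTc l) (Real.exp_pos _).le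

/-! ## §3 Coercivity of the near operators -/

/-- **`Re`-COERCIVITY OF `1 + Knear_b` ON THE WHOLE LATTICE**: from the GLOBAL datum `γ‖z‖² ≤ Re z^*(1 + Σ_ωK_ω)z` and the
far masses: `(γ − e^{−w m₀}(ρ + ρ_c)/2)‖z‖² ≤ Re z^*(1 + Knear_b)z` for every cube `b`.
[cite: Balaban1985BackgroundPropagators, p.422] -/
theorem reCoercive_near (hd0 : ∀ a b, 0 ≤ d a b) {w κp ρ ρc m₀ γ : ℝ} (hw0 : 0 ≤ w) (hκp : 0 ≤ κp)
    (K : Ω → Matrix Y Y ℂ) (cellsOf : Ω → Finset Δ) (near : B → Finset Ω)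
    (hnear : ∀ b ω, ω ∉ near b → m₀ ≤ (cellsOf ω).card)
    (hT : ∀ k, ∑ l, (∑ ω, pieceMaj w K cellsOf ω k l) * Real.exp (κp * d k l) ≤ ρ)
    (hTc : ∀ l, ∑ k, (∑ ω, pieceMaj w K cellsOf ω k l) * Real.exp (κp * d k l) ≤ ρc)
    (hRe : ∀ z : Y → ℂ, γ * nsq z ≤ (star z ⬝ᵥ ((1 + Ktot K) *ᵥ z)).re) (b : B) (z : Y → ℂ) :
    (γ - Real.exp (-(w * m₀)) * (ρ + ρc) / 2) * nsq z ≤ (star z ⬝ᵥ ((1 + Knear K near b) *ᵥ z)).re := by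
  have h := reCoercive_sub (1 + Ktot K) (Ktot K - Knear K near b) hRe
    (rowFar_le hd0 hw0 hκp K cellsOf near hnear hT b) (colFar_le hd0 hw0 hκp K cellsOf near hnear hTc b) z
  have heq : 1 + Ktot K - (Ktot K - Knear K near b) = 1 + Knear K near b := by abel
  rw [heq] at h
  refine le_trans (le_of_eq ?_) h
  ring

end OneBound

/-! ## §4 The near-local inverses of the hand-off -/

section Local

variable {κ : ℝ} {d : Y → Y → ℝ}

/-- **THE NEAR-LOCAL INVERSES FROM ONE BOUND + ONE DATUM.**  Symmetric pseudo-metric `d` (`WeightHyp κ d` + `hds`); pieces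
with cell budgets; ONE bound `hT` (rows) and its column twin `hTc` at rate `κ⁺ ≥ 0`, weight `w ≥ 0` per cell; the
convention `hnear` (every piece outside `near b` has `≥ m₀` cells); the GLOBAL coercivity datum `γ` of `1 + Σ_ωK_ω`;
a conjugation rate `κ_c ≥ 0` with profiles `L₁` (first moment at `κ⁺ − κ_c`) and `L` (zeroth at `κ_c − κ′`); the located
smallness `κ_c·ρ·L₁ < γ′ := γ − e^{−w m₀}(ρ + ρ_c)/2`.  THEN the constructed `L_b := locInv (Knear K near b) E b`
satisfy the three hand-off inputs: `P_bL_b = L_b`, `P_b(1 + Knear_b)P_b·L_b = P_b`, and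
`WRS κ′ d L_b ((γ′ − κ_cρL₁)⁻¹·L)` for every cube `b`. [cite: Balaban1988RG2Cluster, p.13 after (2.7)] -/
theorem nearLocal_of_pieceMaj (hw : WeightHyp κ d) (hds : ∀ i j, d i j = d j i) (K : Ω → Matrix Y Y ℂ)
    (cellsOf : Ω → Finset Δ) (near : B → Finset Ω) (E : B → Finset Y) {w κp ρ ρc m₀ γ κc κ' L₁ L : ℝ}
    (hw0 : 0 ≤ w) (hκp : 0 ≤ κp) (hnear : ∀ b ω, ω ∉ near b → m₀ ≤ (cellsOf ω).card)
    (hT : ∀ k, ∑ l, (∑ ω, pieceMaj w K cellsOf ω k l) * Real.exp (κp * d k l) ≤ ρ)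
    (hTc : ∀ l, ∑ k, (∑ ω, pieceMaj w K cellsOf ω k l) * Real.exp (κp * d k l) ≤ ρc)
    (hRe : ∀ z : Y → ℂ, γ * nsq z ≤ (star z ⬝ᵥ ((1 + Ktot K) *ᵥ z)).re) (hκc : 0 ≤ κc)
    (hL₁ : ∀ i, ∑ j, d i j * Real.exp (-((κp - κc) * d i j)) ≤ L₁)
    (hL : ∀ i, ∑ j, Real.exp (-((κc - κ') * d i j)) ≤ L) (hL0 : 0 ≤ L)
    (hm : κc * ρ * L₁ < γ - Real.exp (-(w * m₀)) * (ρ + ρc) / 2) :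
    (∀ b, Pj E b * locInv (Knear K near b) E b = locInv (Knear K near b) E b) ∧
    (∀ b, Pj E b * (1 + Knear K near b) * Pj E b * locInv (Knear K near b) E b = Pj E b) ∧
    (∀ b, WRS κ' d (locInv (Knear K near b) E b)
      ((γ - Real.exp (-(w * m₀)) * (ρ + ρc) / 2 - κc * ρ * L₁)⁻¹ * L)) := by
  set γ' := γ - Real.exp (-(w * m₀)) * (ρ + ρc) / 2 with hγ'
  -- nonnegativity of ρ from the bound (Y may be empty: then nothing to prove for `hρ0`'s uses)
  have hnear' : ∀ b, ∀ z : Y → ℂ, γ' * nsq z ≤ (star z ⬝ᵥ ((1 + Knear K near b) *ᵥ z)).re := fun b z =>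
    reCoercive_near hw.nonneg hw0 hκp K cellsOf near hnear hT hTc hRe b z
  have hdecay : ∀ b i j, ‖Knear K near b i j‖ ≤ ρ * Real.exp (-(κp * d i j)) := fun b i j =>
    norm_sum_pieces_le hw0 K cellsOf hT (near b) i j
  have hmpos : 0 < γ' - κc * ρ * L₁ := by linarith
  refine ⟨fun b => Pj_mul_extend E b _, fun b => ?_, fun b => ?_⟩
  · -- local-inverse property: the compression is invertible by accretivity
    by_cases hY : Nonempty Y
    · obtain ⟨y⟩ := hY
      have hρ0 : 0 ≤ ρ := le_trans (Finset.sum_nonneg fun l _ => mul_nonneg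
        (Finset.sum_nonneg fun ω _ => mul_nonneg (Real.exp_pos _).le (norm_nonneg _)) (Real.exp_pos _).le) (hT y)
      have hL₁0 : 0 ≤ L₁ := le_trans (Finset.sum_nonneg fun j _ =>
        mul_nonneg (hw.nonneg y j) (Real.exp_pos _).le) (hL₁ y)
      have hγpos : 0 < γ' := by
        have := mul_nonneg (mul_nonneg hκc hρ0) hL₁0
        linarith
      exact Pj_mul_mul_Pj_mul_extend_inv E b (1 + Knear K near b)
        (isUnit_of_reCoercive hγpos (reCoercive_compress (1 + Knear K near b) (hnear' b)))
    · haveI : IsEmpty Y := not_nonempty_iff.1 hY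
      exact Subsingleton.elim _ _
  · -- the WRS budget by accretive Combes–Thomas on the compression
    have hρ0 : ∀ i j : Y, 0 ≤ ρ := fun i _ => le_trans (Finset.sum_nonneg fun l _ => mul_nonneg
      (Finset.sum_nonneg fun ω _ => mul_nonneg (Real.exp_pos _).le (norm_nonneg _)) (Real.exp_pos _).le) (hT i)
    refine wrs_extend_inv_le (E b) (1 + Knear K near b) d hw.zero hκc hmpos hL0 (fun j z => ?_) hL
    have hρ0' : 0 ≤ ρ := hρ0 (j : Y) (j : Y)
    exact conjCoercive_compress_of_decay (Knear K near b) (E b) hw hds hκc hρ0' (hdecay b) (hnear' b) hL₁ j z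

end Local

/-! ## §5 Non-vacuity -/

/-- **NON-VACUITY**: one site, one piece `K ≡ 0` with empty cell budget, `near ≡ univ`, `E ≡ univ`, zero distance,
`w = κ⁺ = κ_c = κ′ = 0`, `ρ = ρ_c = 0`, `m₀ = 0`, `γ = 1`, `L₁ = 0`, `L = 1`: every hypothesis of `nearLocal_of_pieceMaj`
holds and the budget reads `(1 − 1·(0+0)/2 − 0)⁻¹·1`. [folklore] -/
example : (∀ b : Fin 1, Pj (fun _ => (Finset.univ : Finset (Fin 1))) b
      * locInv (Knear (fun _ : Fin 1 => (0 : Matrix (Fin 1) (Fin 1) ℂ)) (fun _ => Finset.univ) b) (fun _ => Finset.univ) b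
      = locInv (Knear (fun _ : Fin 1 => (0 : Matrix (Fin 1) (Fin 1) ℂ)) (fun _ => Finset.univ) b) (fun _ => Finset.univ) b)
    ∧ (∀ b : Fin 1, Pj (fun _ => (Finset.univ : Finset (Fin 1))) b
      * (1 + Knear (fun _ : Fin 1 => (0 : Matrix (Fin 1) (Fin 1) ℂ)) (fun _ => Finset.univ) b)
      * Pj (fun _ => (Finset.univ : Finset (Fin 1))) b
      * locInv (Knear (fun _ : Fin 1 => (0 : Matrix (Fin 1) (Fin 1) ℂ)) (fun _ => Finset.univ) b) (fun _ => Finset.univ) b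
      = Pj (fun _ => (Finset.univ : Finset (Fin 1))) b)
    ∧ (∀ b : Fin 1, WRS 0 (fun _ _ : Fin 1 => (0 : ℝ))
      (locInv (Knear (fun _ : Fin 1 => (0 : Matrix (Fin 1) (Fin 1) ℂ)) (fun _ => Finset.univ) b) (fun _ => Finset.univ) b)
      ((1 - Real.exp (-(0 * 0)) * (0 + 0) / 2 - 0 * 0 * 0)⁻¹ * 1)) := by
  have hw : WeightHyp (n := Fin 1) 0 (fun _ _ => (0 : ℝ)) := ⟨le_rfl, fun _ => rfl, fun _ _ => le_rfl, fun _ _ _ => by simp⟩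
  refine nearLocal_of_pieceMaj (Δ := Fin 1) hw (fun _ _ => rfl) (fun _ : Fin 1 => (0 : Matrix (Fin 1) (Fin 1) ℂ))
    (fun _ => ∅) (fun _ => Finset.univ) (fun _ => Finset.univ) (w := 0) (κp := 0) (ρ := 0) (ρc := 0) (m₀ := 0)
    (γ := 1) (κc := 0) (κ' := 0) (L₁ := 0) (L := 1) le_rfl le_rfl (fun b ω hω => absurd (Finset.mem_univ ω) hω)
    (fun k => by simp [pieceMaj]) (fun l => by simp [pieceMaj]) (fun z => ?_) le_rfl (fun i => by simp)
    (fun i => by simp) zero_le_one (by norm_num)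
  have hK : Ktot (fun _ : Fin 1 => (0 : Matrix (Fin 1) (Fin 1) ℂ)) = 0 := by simp [Ktot]
  have hform : star z ⬝ᵥ ((1 : Matrix (Fin 1) (Fin 1) ℂ) *ᵥ z) = ((nsq z : ℝ) : ℂ) := by
    rw [← AccretiveCombesThomas.conjForm_zero_rate 1 (fun _ => (0 : ℝ)) z,
      UnitLatticeWalkInversionDecay.conjForm_one]
  rw [hK, add_zero, hform, Complex.ofReal_re, one_mul]

end

end Summit.QuantumFields.BalabanUV.Beta.UnitLatticeOmegaLocal
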